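import Summits.PneNP.PneNP.Theorems.SymmetryBudgetHamCompilesDefs

/-!
# Interface, residual predicates and residual language of the line `kotzig-cutspan`
# (crux `SymmetryBudget.HamCompiles`, stmt-PneNP-10637) — definitions, part 2

Continuation of `SymmetryBudgetHamCompilesDefs.lean` (same namespace): §4 the A-side blocks
`aData`, the row space `rowSpace` of an F-block and the residual predicates `Residue₀` (graph
level, target of the line's `stub_cutspan`) / `Residue` (block level, the `NP` predicate of the
line's `stub_residueNP`); §5 the whole invariant interface `iface`; §6 its string layout `encode`
(explicit `Fin` equivalences, length `ell m`) and the residual language `ResidueLang`.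
-/

-- `Summit.PneNP.PneNP.…` duplicates `PneNP` BY DESIGN (single-problem summit, D-0017).
set_option linter.dupNamespace false

noncomputable section

namespace Summit.PneNP.PneNP.Theorems.HamCompilesKC

open Literature.Computability.Complexity
open Finset

/-! ### §4 The A-side blocks and the residual predicates -/

section AData

variable (m : ℕ)

/-- Index type of the A-side interface: matrix positions (only anchored × anchored ones carry
input bits) and (rank, vertex) pairs for the class-membership table `N`. -/
abbrev AIdx (m : ℕ) : Type := (Fin m × Fin m) ⊕ (Fin (gOf m) × Fin m)

open scoped Classical in
/-- **The A-side interface** `aData m x`: the anchored block of the matrix, and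
`N(i, a) = [a is an A-neighbour of the free class of rank i]`. Bud-invariant wires. -/
def aData (x : Fin m × Fin m → Bool) : AIdx m → Bool
  | Sum.inl (a, a') => decide (IsAnch m a ∧ IsAnch m a' ∧ x (a, a') = true)
  | Sum.inr (i, a) => decide (∃ u ∈ freeSet m, rk m x u = (i : ℕ) ∧ a ∈ cls m x u)

/-- The row space read off an F-block at code word `wd`. -/
def rowSpace (fb : FIdx m → Bool) (wd : Fin (3 * gOf m) → Bool) :
    Submodule (ZMod 2) (Vec (gOf m)) :=
  Submodule.span (ZMod 2)
    (Set.range fun S : Fin (gOf m) → Bool => fun S' => if fb (wd, S, S') = true then 1 else 0)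

/-- The A-side conditions common to both residual predicates: a rank-labelled path cover of the
anchored graph read off the block `ab`, label validity against the table `N`, A-slots `d`. -/
def ACover (ab : AIdx m → Bool) (d : Fin (gOf m) → ℕ)
    (PA : List (VSeq (Fin m) × (Fin (gOf m) × Fin (gOf m)))) : Prop :=
  IsCoverOf (SimpleGraph.fromRel fun u v : Fin m => ab (Sum.inl (u, v)) = true) (freeSet m)ᶜ
      (PA.map Prod.fst) ∧
    (∀ q ∈ PA, ab (Sum.inr (q.2.1, q.1.first)) = true ∧ ab (Sum.inr (q.2.2, q.1.last)) = true) ∧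
    (∀ i, aSlots PA i = d i)

/-- **The graph-level residual predicate** (target of the line's `stub_cutspan`): some margin vector `d`, some
rank-labelled A-cover with A-slots `d`, and some vector of the SPAN `W_F(d)` having odd pairing with
the A-side anchored-cut vector (= "the junction multigraph is connected for SOME F-cover of margins
`d`", by cut parity and linearity). -/
def Residue₀ (x : Fin m × Fin m → Bool) : Prop :=
  ∃ d : Fin (gOf m) → ℕ, (∑ t, d t) ≤ 2 * gOf m ∧
    ∃ PA : List (VSeq (Fin m) × (Fin (gOf m) × Fin (gOf m))), ACover m (aData m x) d PA ∧
      ∃ w ∈ WF m x d, ∑ S : Fin (gOf m) → Bool, w S * vA d PA S = 1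

/-- **The block-level residual predicate** on interface blocks (an `NP` predicate of `poly(m)`
bits; target of the line's `stub_residueNP`): as `Residue₀`, with "some vector of the span" replaced by "some
ROW `S₀` of the F-block at the code word of `d`" (equivalent by linearity: a functional vanishes on a
span iff on its generators). Certificate: `(d, PA, S₀)`. -/
def Residue (ab : AIdx m → Bool) (fb : FIdx m → Bool) : Prop :=
  ∃ d : Fin (gOf m) → ℕ, (∑ t, d t) ≤ 2 * gOf m ∧
    ∃ PA : List (VSeq (Fin m) × (Fin (gOf m) × Fin (gOf m))), ACover m ab d PA ∧
      ∃ S₀ : Fin (gOf m) → Bool, ∑ S : Fin (gOf m) → Bool,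
        (if fb (sbCode d, S₀, S) = true then (1 : ZMod 2) else 0) * vA d PA S = 1

end AData


/-! ### §5 The invariant interface -/

/-- Index type of the whole invariant interface. -/
abbrev IIdx (m : ℕ) : Type := AIdx m ⊕ FIdx m

/-- The invariant interface `iface m x = (aData m x, fData m x)`: `poly(m)` Bud(m,g)-invariant bits
that determine `HAM_m(x)` (stubs `stub_kotzig`, `stub_cutspan`, `stub_spanRecursion`, `stub_rref` of the line). -/
def iface (m : ℕ) (x : Fin m × Fin m → Bool) : IIdx m → Bool :=
  Sum.elim (aData m x) (fData m x)



/-! ### §6 Layout of the interface as a string; the residual language -/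

/-- Length of the interface string. Strictly increasing in `m` (so `m` is read off the length)
and `≤ 2m² + m⁵`. -/
def ell (m : ℕ) : ℕ := (m * m + gOf m * m) + 2 ^ (3 * gOf m) * (2 ^ gOf m * 2 ^ gOf m)

/-- Explicit bijection `(Fin n → Bool) ≃ Fin (2^n)` (binary numbers; no choice). -/
def boolVecEquiv (n : ℕ) : (Fin n → Bool) ≃ Fin (2 ^ n) :=
  (Equiv.arrowCongr (Equiv.refl (Fin n)) finTwoEquiv.symm).trans finFunctionFinEquiv

/-- Explicit layout of the A-indices. -/
def aIdxEquiv (m : ℕ) : AIdx m ≃ Fin (m * m + gOf m * m) :=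
  (Equiv.sumCongr finProdFinEquiv finProdFinEquiv).trans finSumFinEquiv

/-- Explicit layout of the F-indices. -/
def fIdxEquiv (m : ℕ) : FIdx m ≃ Fin (2 ^ (3 * gOf m) * (2 ^ gOf m * 2 ^ gOf m)) :=
  (Equiv.prodCongr (boolVecEquiv _)
      ((Equiv.prodCongr (boolVecEquiv _) (boolVecEquiv _)).trans finProdFinEquiv)).trans
    finProdFinEquiv

/-- Explicit layout of the whole interface (A-block first). -/
def iIdxEquiv (m : ℕ) : IIdx m ≃ Fin (ell m) :=
  (Equiv.sumCongr (aIdxEquiv m) (fIdxEquiv m)).trans finSumFinEquiv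

/-- The interface string of a bit assignment. -/
def encode (m : ℕ) (v : IIdx m → Bool) : List Bool :=
  List.ofFn fun j : Fin (ell m) => v ((iIdxEquiv m).symm j)


/-- The interface string has length `ell m`. -/
theorem encode_length (m : ℕ) (v : IIdx m → Bool) : (encode m v).length = ell m := by
  simp [encode]

/-- **The residual language**: interface strings (any `m ≥ 4`) whose blocks satisfy the residual
predicate. Membership depends on the string only through its parsed blocks (no reference to a
graph), so it is an honest `NP` language (stub `stub_residueNP` of the line). -/
def ResidueLang : Language Bool :=
  {s : List Bool | ∃ m : ℕ, 4 ≤ m ∧ ∃ (ab : AIdx m → Bool) (fb : FIdx m → Bool),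
    s = encode m (Sum.elim ab fb) ∧ Residue m ab fb}


end Summit.PneNP.PneNP.Theorems.HamCompilesKC
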